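import Summits.ABC.ABC.Theorems.FeketeScalesScaleSubmultiplicativityNormalForms

/-!
# Crux `ScaleSubmultiplicativity` (stmt-ABC-2160): saturation of the abc quality record

A consequence of the crux with bite on RECORDS (the objects of de Weger's / von Känel–Matschke's tables).  Write
`q(T) := log c / log rad(abc)` for the quality of an abc triple `T = (a,b,c)` (tree `quality`) and
`q_max(R) := max {q(T) : rad T ≤ R}` for the quality record up to radical scale `R` (a finite max by abc.S25,
PROVED: `finite_setOf_isABCTriple_primeFactors_subset_holds`).  Then

* `ScaleSubmultiplicativity.recordSaturation_of_scaleSubmultiplicativity`: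
  `ScaleSubmultiplicativity → ∃ θ ∈ [0,1), ∃ C, ∀ R ≥ 2, ∀ T', ∃ T with rad T ≤ R, q(T') ≤ q(T) + C (log R)^{θ-1}`,
  i.e. **under the crux the all-time supremum of abc qualities exceeds the record observed up to ANY scale `R` by
  at most `C (log R)^{θ-1} → 0`**: `sup_T q(T) ≤ q_max(R) + C (log R)^{θ-1}` for every `R ≥ 2`.  (Polynomial abc,
  stmt-ABC-2163, is the qualitative shadow `sup q < ∞`; the Fekete limit of lead c4, `GrowthExponent`, concerns
  `lim log G(R)/log R`, which sits below the quality record.)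

Proof (a Fekete iteration along SQUARINGS of the scale, in the threshold-2 normal form
`ScaleSubmultiplicativity.iff_threshold_two`).  ONE STEP (`step`): if every triple of radical `≤ S` has quality
`≤ B`, then every triple `T` with `S < r := rad T ≤ S²` has, with the multiplier `m := ⌈r/S⌉ ∈ [2, S]`, shadows
`T₁, T₂` at the scales `(m, S)`: `c ≤ K e^{(log mS)^θ} c₁ c₂`, `log cᵢ = q(Tᵢ) log rad Tᵢ` with `q(Tᵢ) ≤ min(B, Q*)`
(`Q* := sup q < ∞` from stmt-ABC-2163) and `log rad T₁ + log rad T₂ ≤ log (mS) ≤ log r + log 2`; hence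
`log c ≤ B log r + Q* log 2 + log⁺K + 2 (log r)^θ` and `q(T) ≤ B + c₁ (log S)^{θ-1}`, `c₁ := log⁺K + Q* log 2 + 2`.
ITERATION (`iterate`) along `R, R², R⁴, …`: the increments `c₁ (2ᵏ log R)^{θ-1}` form a geometric series with ratio
`2^{θ-1} < 1`, so every quality is at most `q_max(R) + c₁ (log R)^{θ-1} / (1 - 2^{θ-1})`.

A CONSEQUENCE of the crux (`--supports stmt-ABC-2160`); no bearing on its provability
(cf. `Cruxes/ScaleSubmultiplicativity/STRATEGY-CENSUS.md`, whose §S3 `MonotoneRecordQuality` is the converse-type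
strengthening).  Pattern: M. Fekete (1923); de Bruijn–Erdős (1952) for perturbed sub-additivity.
-/

-- `Summit.<Summit>.<Problem>` is the mandated summit-side namespace (CONVENTIONS §2); for the
-- single-conjunct summit `ABC` the two coincide, so the duplicate `ABC.ABC` is deliberate.
set_option linter.dupNamespace false

noncomputable section

namespace Summit.ABC.ABC.Theorems

open Literature.NumberTheory.DiophantineGeometry
open Summit.ABC.ABC.Theses.FeketeScales

namespace ScaleSubmultiplicativity.RecordSaturation

/-! ### Quality bookkeeping -/

/-- For an abc triple, `log rad(abc) > 0`. [folklore] -/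
theorem log_rad_pos {a b c : ℕ} (h : IsABCTriple a b c) : 0 < Real.log ((rad a b c : ℕ) : ℝ) :=
  Real.log_pos (by exact_mod_cast h.two_le_rad)

/-- For an abc triple, `log c = q(T) · log rad(abc)`. [folklore] -/
theorem log_eq_quality_mul {a b c : ℕ} (h : IsABCTriple a b c) :
    Real.log c = quality a b c * Real.log ((rad a b c : ℕ) : ℝ) := by
  rw [quality, div_mul_cancel₀ _ (log_rad_pos h).ne']

/-- The quality of an abc triple is non-negative. [folklore] -/
theorem quality_nonneg {a b c : ℕ} (h : IsABCTriple a b c) : 0 ≤ quality a b c := by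
  rw [quality]
  exact div_nonneg (Real.log_nonneg (by exact_mod_cast le_trans one_le_two h.two_le)) (log_rad_pos h).le

/-- **Qualities are bounded under the crux** (polynomial abc, stmt-ABC-2163, PROVED:
`polynomialAbcOfSubmult_proof` with abc.S25 discharged): some `Q* ≥ 0` bounds every quality. [folklore] -/
theorem exists_quality_bound (h : Summit.ABC.ABC.Theses.FeketeScales.ScaleSubmultiplicativity) :
    ∃ Qs : ℝ, 0 ≤ Qs ∧ ∀ a b c : ℕ, IsABCTriple a b c → quality a b c ≤ Qs := by
  obtain ⟨A, C, hAC⟩ := polynomialAbcOfSubmult_proof h finite_setOf_isABCTriple_primeFactors_subset_holds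
  refine ⟨|A| + |Real.log C| / Real.log 2, by positivity, fun a b c hT => ?_⟩
  have hc2 : (2 : ℝ) ≤ c := by exact_mod_cast hT.two_le
  have hr2 : (2 : ℝ) ≤ ((rad a b c : ℕ) : ℝ) := by exact_mod_cast hT.two_le_rad
  have hr0 : (0 : ℝ) < ((rad a b c : ℕ) : ℝ) := by linarith
  have hlr : 0 < Real.log ((rad a b c : ℕ) : ℝ) := log_rad_pos hT
  have hl2 : Real.log 2 ≤ Real.log ((rad a b c : ℕ) : ℝ) := Real.log_le_log two_pos hr2
  have hlog2 : 0 < Real.log 2 := Real.log_pos one_lt_two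
  have hpow : 0 < ((rad a b c : ℕ) : ℝ) ^ A := Real.rpow_pos_of_pos hr0 A
  have hcle := hAC a b c hT
  have hC : 0 < C := by
    by_contra hC
    push Not at hC
    have : C * ((rad a b c : ℕ) : ℝ) ^ A ≤ 0 := mul_nonpos_of_nonpos_of_nonneg hC hpow.le
    linarith
  -- `log c ≤ log C + A log rad`
  have hlogc : Real.log c ≤ Real.log C + A * Real.log ((rad a b c : ℕ) : ℝ) := by
    have := Real.log_le_log (by linarith) hcle
    rwa [Real.log_mul hC.ne' hpow.ne', Real.log_rpow hr0] at this
  rw [quality, div_le_iff₀ hlr]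
  have h1 : Real.log C ≤ |Real.log C| / Real.log 2 * Real.log ((rad a b c : ℕ) : ℝ) := by
    rw [div_mul_eq_mul_div, le_div_iff₀ hlog2]
    calc Real.log C * Real.log 2 ≤ |Real.log C| * Real.log 2 :=
          mul_le_mul_of_nonneg_right (le_abs_self _) hlog2.le
      _ ≤ |Real.log C| * Real.log ((rad a b c : ℕ) : ℝ) := mul_le_mul_of_nonneg_left hl2 (abs_nonneg _)
  have h2 : A * Real.log ((rad a b c : ℕ) : ℝ) ≤ |A| * Real.log ((rad a b c : ℕ) : ℝ) :=
    mul_le_mul_of_nonneg_right (le_abs_self _) hlr.le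
  calc Real.log c ≤ Real.log C + A * Real.log ((rad a b c : ℕ) : ℝ) := hlogc
    _ ≤ |Real.log C| / Real.log 2 * Real.log ((rad a b c : ℕ) : ℝ) + |A| * Real.log ((rad a b c : ℕ) : ℝ) :=
        add_le_add h1 h2
    _ = (|A| + |Real.log C| / Real.log 2) * Real.log ((rad a b c : ℕ) : ℝ) := by ring

/-- **The quality record up to scale `R ≥ 2` is attained**: some abc triple of radical `≤ R` has maximal quality
among all abc triples of radical `≤ R` (a finite, non-empty set: abc.S25 and `(1,1,2)`). [folklore] -/
theorem exists_record {R : ℕ} (hR : 2 ≤ R) :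
    ∃ a b c : ℕ, IsABCTriple a b c ∧ rad a b c ≤ R ∧
      ∀ a' b' c' : ℕ, IsABCTriple a' b' c' → rad a' b' c' ≤ R → quality a' b' c' ≤ quality a b c := by
  have hfin : {t : ℕ × ℕ × ℕ | IsABCTriple t.1 t.2.1 t.2.2 ∧ rad t.1 t.2.1 t.2.2 ≤ R}.Finite :=
    (finite_setOf_isABCTriple_primeFactors_subset_holds (Finset.range (R + 1))).subset
      (fun t ht => ⟨ht.1, feketeScales_primeFactors_subset_range_of_rad_le ht.2⟩)
  have hne : hfin.toFinset.Nonempty := by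
    refine ⟨(1, 1, 2), ?_⟩
    rw [Set.Finite.mem_toFinset]
    exact ⟨NormalForms.isABCTriple_one_one_two, by
      show rad 1 1 2 ≤ R
      rw [rad_one_one_two]; exact hR⟩
  obtain ⟨t, ht, hmax⟩ := hfin.toFinset.exists_max_image (fun t : ℕ × ℕ × ℕ => quality t.1 t.2.1 t.2.2) hne
  rw [Set.Finite.mem_toFinset] at ht
  refine ⟨t.1, t.2.1, t.2.2, ht.1, ht.2, fun a' b' c' hT' hr' => ?_⟩
  have := hmax (a', b', c') (by rw [Set.Finite.mem_toFinset]; exact ⟨hT', hr'⟩)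
  exact this

/-! ### One step: from scale `S` to scale `S²` -/

/-- Splitting of the two shadow heights: if `q₁, q₂ ≤ min(B, Q*)` are the qualities of the shadows, `ℓ₁, ℓ₂ ≥ 0`
their log-radicals with `ℓ₁ + ℓ₂ ≤ ℓ + log 2`, and `B, Q* ≥ 0`, then `q₁ ℓ₁ + q₂ ℓ₂ ≤ B ℓ + Q* log 2`. [folklore] -/
theorem split_heights {q₁ q₂ ℓ₁ ℓ₂ ℓ B Qs : ℝ} (hB0 : 0 ≤ B) (hQs0 : 0 ≤ Qs)
    (hq₁0 : 0 ≤ q₁) (hq₁B : q₁ ≤ B) (hq₂B : q₂ ≤ B) (hq₁Q : q₁ ≤ Qs) (hq₂Q : q₂ ≤ Qs)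
    (hℓ₁ : 0 ≤ ℓ₁) (hℓ₂ : 0 ≤ ℓ₂) (hℓ : 0 ≤ ℓ) (hsum : ℓ₁ + ℓ₂ ≤ ℓ + Real.log 2) :
    q₁ * ℓ₁ + q₂ * ℓ₂ ≤ B * ℓ + Qs * Real.log 2 := by
  have hlog2 : 0 ≤ Real.log 2 := (Real.log_pos one_lt_two).le
  -- `u := max q₁ q₂`
  have hu1 : q₁ * ℓ₁ + q₂ * ℓ₂ ≤ max q₁ q₂ * (ℓ₁ + ℓ₂) := by
    have e1 : q₁ * ℓ₁ ≤ max q₁ q₂ * ℓ₁ := mul_le_mul_of_nonneg_right (le_max_left _ _) hℓ₁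
    have e2 : q₂ * ℓ₂ ≤ max q₁ q₂ * ℓ₂ := mul_le_mul_of_nonneg_right (le_max_right _ _) hℓ₂
    linarith
  have huB : max q₁ q₂ ≤ B := max_le hq₁B hq₂B
  have huQ : max q₁ q₂ ≤ Qs := max_le hq₁Q hq₂Q
  have hu0 : 0 ≤ max q₁ q₂ := le_max_of_le_left hq₁0
  rcases le_or_gt (ℓ₁ + ℓ₂) ℓ with hle | hgt
  · calc q₁ * ℓ₁ + q₂ * ℓ₂ ≤ max q₁ q₂ * (ℓ₁ + ℓ₂) := hu1
      _ ≤ B * (ℓ₁ + ℓ₂) := mul_le_mul_of_nonneg_right huB (by linarith)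
      _ ≤ B * ℓ := mul_le_mul_of_nonneg_left hle hB0
      _ ≤ B * ℓ + Qs * Real.log 2 := le_add_of_nonneg_right (mul_nonneg hQs0 hlog2)
  · calc q₁ * ℓ₁ + q₂ * ℓ₂ ≤ max q₁ q₂ * (ℓ₁ + ℓ₂) := hu1
      _ = max q₁ q₂ * ℓ + max q₁ q₂ * (ℓ₁ + ℓ₂ - ℓ) := by ring
      _ ≤ B * ℓ + Qs * Real.log 2 := by
          have e1 : max q₁ q₂ * ℓ ≤ B * ℓ := mul_le_mul_of_nonneg_right huB hℓ
          have e2 : max q₁ q₂ * (ℓ₁ + ℓ₂ - ℓ) ≤ Qs * Real.log 2 :=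
            mul_le_mul huQ (by linarith) (by linarith) hQs0
          linarith

/-- The slack at radical `r ≥ 3`: `log⁺K + Q* log 2 + (log r + log 2)^θ ≤ (log⁺K + Q* log 2 + 2) (log r)^θ`
(`0 ≤ θ ≤ 1`; uses `log r ≥ 1` and `(x + log 2)^θ ≤ (2x)^θ ≤ 2 x^θ`). [folklore] -/
theorem slack_le {θ L Qs r : ℝ} (hθ0 : 0 ≤ θ) (hθ1 : θ ≤ 1) (hL : 0 ≤ L) (hQs : 0 ≤ Qs) (hr : 3 ≤ r) :
    L + Qs * Real.log 2 + (Real.log r + Real.log 2) ^ θ ≤ (L + Qs * Real.log 2 + 2) * Real.log r ^ θ := by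
  have hlog2 : 0 ≤ Real.log 2 := (Real.log_pos one_lt_two).le
  have hlr1 : 1 ≤ Real.log r := by
    rw [Real.le_log_iff_exp_le (by linarith)]
    exact Real.exp_one_lt_three.le.trans hr
  have hlr0 : 0 ≤ Real.log r := zero_le_one.trans hlr1
  have hl2r : Real.log 2 ≤ Real.log r := Real.log_le_log two_pos (by linarith)
  have hpow1 : 1 ≤ Real.log r ^ θ := Real.one_le_rpow hlr1 hθ0
  have h2θ : (2 : ℝ) ^ θ ≤ 2 := by
    calc (2 : ℝ) ^ θ ≤ (2 : ℝ) ^ (1 : ℝ) := Real.rpow_le_rpow_of_exponent_le one_le_two hθ1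
      _ = 2 := Real.rpow_one 2
  have hmain : (Real.log r + Real.log 2) ^ θ ≤ 2 * Real.log r ^ θ := by
    calc (Real.log r + Real.log 2) ^ θ ≤ (2 * Real.log r) ^ θ :=
          Real.rpow_le_rpow (by linarith) (by linarith) hθ0
      _ = (2 : ℝ) ^ θ * Real.log r ^ θ := Real.mul_rpow zero_le_two hlr0
      _ ≤ 2 * Real.log r ^ θ := mul_le_mul_of_nonneg_right h2θ (zero_le_one.trans hpow1)
  have hA : L + Qs * Real.log 2 ≤ (L + Qs * Real.log 2) * Real.log r ^ θ := by
    have : 0 ≤ L + Qs * Real.log 2 := by positivity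
    calc L + Qs * Real.log 2 = (L + Qs * Real.log 2) * 1 := (mul_one _).symm
      _ ≤ (L + Qs * Real.log 2) * Real.log r ^ θ := mul_le_mul_of_nonneg_left hpow1 this
  linarith

/-- **One squaring step.**  Under the threshold-2 form of the crux (`0 ≤ θ ≤ 1`, `K > 0`), if every quality is
`≤ Q*` and every triple of radical `≤ S` (`S ≥ 2`) has quality `≤ B` (`B ≥ 0`), then every triple of radical
`≤ S²` has quality `≤ B + (log⁺K + Q* log 2 + 2) (log S)^{θ-1}`: for `S < r = rad T ≤ S²` shadow `T` at the scales
`(⌈r/S⌉, S)` and split the heights of the shadows (`split_heights`, `slack_le`). [folklore] -/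
theorem step {θ K Qs B : ℝ} {S : ℕ} (hθ0 : 0 ≤ θ) (hθ1 : θ ≤ 1) (hK : 0 < K)
    (hS : ∀ R₁ R₂ : ℕ, 2 ≤ R₁ → 2 ≤ R₂ → ∀ a b c : ℕ, IsABCTriple a b c → rad a b c ≤ R₁ * R₂ →
      ∃ a₁ b₁ c₁ a₂ b₂ c₂ : ℕ, IsABCTriple a₁ b₁ c₁ ∧ rad a₁ b₁ c₁ ≤ R₁ ∧ IsABCTriple a₂ b₂ c₂ ∧
        rad a₂ b₂ c₂ ≤ R₂ ∧ (c : ℝ) ≤ K * Real.exp (Real.log ((R₁ : ℝ) * R₂) ^ θ) * c₁ * c₂)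
    (hQs0 : 0 ≤ Qs) (hQs : ∀ a b c : ℕ, IsABCTriple a b c → quality a b c ≤ Qs)
    (h2S : 2 ≤ S) (hB0 : 0 ≤ B)
    (hB : ∀ a b c : ℕ, IsABCTriple a b c → rad a b c ≤ S → quality a b c ≤ B) :
    ∀ a b c : ℕ, IsABCTriple a b c → rad a b c ≤ S * S →
      quality a b c ≤ B + (max (Real.log K) 0 + Qs * Real.log 2 + 2) * Real.log (S : ℝ) ^ (θ - 1) := by
  intro a b c hT hr
  set c₁K : ℝ := max (Real.log K) 0 + Qs * Real.log 2 + 2 with hc₁K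
  have hlog2 : 0 ≤ Real.log 2 := (Real.log_pos one_lt_two).le
  have hc₁K0 : 0 ≤ c₁K := by rw [hc₁K]; positivity
  have hS1 : (1 : ℝ) < S := by exact_mod_cast h2S
  have hlogS : 0 < Real.log (S : ℝ) := Real.log_pos hS1
  have hinc : 0 ≤ c₁K * Real.log (S : ℝ) ^ (θ - 1) := mul_nonneg hc₁K0 (Real.rpow_nonneg hlogS.le _)
  rcases le_or_gt (rad a b c) S with hsmall | hbig
  · exact (hB a b c hT hsmall).trans (le_add_of_nonneg_right hinc)
  -- `S < r ≤ S²`; multiplier `m = ⌈r/S⌉`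
  set r : ℕ := rad a b c with hr_def
  have hSpos : 0 < S := by omega
  set m : ℕ := (r + S - 1) / S with hm_def
  have hm_ge : r ≤ m * S := by
    have := Nat.lt_div_mul_add (a := r + S - 1) hSpos
    rw [← hm_def] at this
    omega
  have hm_le : m * S ≤ r + S - 1 := Nat.div_mul_le_self _ _
  have hm2 : 2 ≤ m := by
    rw [hm_def, Nat.le_div_iff_mul_le hSpos]
    omega
  have hmS : m ≤ S := by
    have : m < S + 1 := by
      rw [hm_def, Nat.div_lt_iff_lt_mul hSpos]
      have e : (S + 1) * S = S * S + S := by ring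
      rw [e]; omega
    omega
  -- shadows at the scales `(m, S)`
  obtain ⟨a₁, b₁, c₁, a₂, b₂, c₂, h₁, hr₁, h₂, hr₂, hc⟩ := hS m S hm2 h2S a b c hT hm_ge
  -- qualities of the shadows
  have hq₁B : quality a₁ b₁ c₁ ≤ B := hB _ _ _ h₁ (hr₁.trans hmS)
  have hq₂B : quality a₂ b₂ c₂ ≤ B := hB _ _ _ h₂ hr₂
  -- real-number facts
  have hr3 : 3 ≤ r := by omega
  have hr3' : (3 : ℝ) ≤ (r : ℝ) := by exact_mod_cast hr3
  have hrpos : (0 : ℝ) < (r : ℝ) := by linarith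
  have hlr : 0 < Real.log (r : ℝ) := Real.log_pos (by linarith)
  have hlr1 : 1 ≤ Real.log (r : ℝ) := by
    rw [Real.le_log_iff_exp_le hrpos]
    exact Real.exp_one_lt_three.le.trans hr3'
  have hc0 : (0 : ℝ) < c := by exact_mod_cast lt_of_lt_of_le two_pos hT.two_le
  have hc₁0 : (0 : ℝ) < c₁ := by exact_mod_cast lt_of_lt_of_le two_pos h₁.two_le
  have hc₂0 : (0 : ℝ) < c₂ := by exact_mod_cast lt_of_lt_of_le two_pos h₂.two_le
  have hexp0 : 0 < Real.exp (Real.log ((m : ℝ) * S) ^ θ) := Real.exp_pos _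
  -- `log (m S) ≤ log r + log 2`
  have hmS2r : (m : ℝ) * S ≤ 2 * r := by
    have : m * S ≤ 2 * r := by omega
    exact_mod_cast this
  have hmS1 : (1 : ℝ) ≤ (m : ℝ) * S := by
    have : 1 ≤ m * S := by nlinarith
    exact_mod_cast this
  have hlogmS : Real.log ((m : ℝ) * S) ≤ Real.log r + Real.log 2 := by
    calc Real.log ((m : ℝ) * S) ≤ Real.log (2 * r) := Real.log_le_log (by linarith) hmS2r
      _ = Real.log r + Real.log 2 := by rw [Real.log_mul two_ne_zero hrpos.ne']; ring
  have hlogmS0 : 0 ≤ Real.log ((m : ℝ) * S) := Real.log_nonneg hmS1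
  -- `log rad₁ + log rad₂ ≤ log (m S)`
  have hrad₁ : Real.log ((rad a₁ b₁ c₁ : ℕ) : ℝ) ≤ Real.log (m : ℝ) :=
    Real.log_le_log (by exact_mod_cast lt_of_lt_of_le two_pos h₁.two_le_rad) (by exact_mod_cast hr₁)
  have hrad₂ : Real.log ((rad a₂ b₂ c₂ : ℕ) : ℝ) ≤ Real.log (S : ℝ) :=
    Real.log_le_log (by exact_mod_cast lt_of_lt_of_le two_pos h₂.two_le_rad) (by exact_mod_cast hr₂)
  have hm0 : (0 : ℝ) < m := by exact_mod_cast lt_of_lt_of_le two_pos hm2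
  have hS0 : (0 : ℝ) < S := by exact_mod_cast hSpos
  have hsum : Real.log ((rad a₁ b₁ c₁ : ℕ) : ℝ) + Real.log ((rad a₂ b₂ c₂ : ℕ) : ℝ) ≤
      Real.log r + Real.log 2 := by
    calc Real.log ((rad a₁ b₁ c₁ : ℕ) : ℝ) + Real.log ((rad a₂ b₂ c₂ : ℕ) : ℝ)
        ≤ Real.log (m : ℝ) + Real.log (S : ℝ) := add_le_add hrad₁ hrad₂
      _ = Real.log ((m : ℝ) * S) := (Real.log_mul hm0.ne' hS0.ne').symm
      _ ≤ Real.log r + Real.log 2 := hlogmS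
  -- heights of the shadows: `log c₁ + log c₂ ≤ B log r + Q* log 2`
  have hheights : Real.log c₁ + Real.log c₂ ≤ B * Real.log r + Qs * Real.log 2 := by
    rw [log_eq_quality_mul h₁, log_eq_quality_mul h₂]
    exact split_heights hB0 hQs0 (quality_nonneg h₁) hq₁B hq₂B
      (hQs _ _ _ h₁) (hQs _ _ _ h₂) (log_rad_pos h₁).le (log_rad_pos h₂).le hlr.le hsum
  -- take logarithms in `c ≤ K e^{(log mS)^θ} c₁ c₂`
  have hlogc : Real.log c ≤ Real.log K + Real.log ((m : ℝ) * S) ^ θ + Real.log c₁ + Real.log c₂ := by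
    have := Real.log_le_log hc0 hc
    rw [Real.log_mul (by positivity) hc₂0.ne', Real.log_mul (by positivity) hc₁0.ne',
      Real.log_mul hK.ne' hexp0.ne', Real.log_exp] at this
    linarith
  have hslack1 : Real.log ((m : ℝ) * S) ^ θ ≤ (Real.log r + Real.log 2) ^ θ :=
    Real.rpow_le_rpow hlogmS0 hlogmS hθ0
  have hlogK : Real.log K ≤ max (Real.log K) 0 := le_max_left _ _
  have hslack := slack_le hθ0 hθ1 (le_max_right (Real.log K) 0) hQs0 hr3'
  -- assemble: `log c ≤ B log r + c₁K (log r)^θ`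
  have hfinal : Real.log c ≤ B * Real.log r + c₁K * Real.log r ^ θ := by
    rw [hc₁K]; linarith
  -- divide by `log r` and compare `(log r)^{θ-1} ≤ (log S)^{θ-1}`
  have hq : quality a b c ≤ B + c₁K * Real.log r ^ (θ - 1) := by
    rw [quality, ← hr_def, div_le_iff₀ hlr]
    have e : (B + c₁K * Real.log (r : ℝ) ^ (θ - 1)) * Real.log r = B * Real.log r + c₁K * Real.log r ^ θ := by
      have : Real.log (r : ℝ) ^ (θ - 1) * Real.log r = Real.log r ^ θ := by
        calc Real.log (r : ℝ) ^ (θ - 1) * Real.log r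
            = Real.log (r : ℝ) ^ (θ - 1) * Real.log (r : ℝ) ^ (1 : ℝ) := by rw [Real.rpow_one]
          _ = Real.log (r : ℝ) ^ (θ - 1 + 1) := (Real.rpow_add hlr _ _).symm
          _ = Real.log (r : ℝ) ^ θ := by ring_nf
      calc (B + c₁K * Real.log (r : ℝ) ^ (θ - 1)) * Real.log r
          = B * Real.log r + c₁K * (Real.log (r : ℝ) ^ (θ - 1) * Real.log r) := by ring
        _ = _ := by rw [this]
    rw [e]; exact hfinal
  have hmono : Real.log (r : ℝ) ^ (θ - 1) ≤ Real.log (S : ℝ) ^ (θ - 1) := by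
    have hSr : Real.log (S : ℝ) ≤ Real.log (r : ℝ) :=
      Real.log_le_log hS0 (by exact_mod_cast hbig.le)
    exact Real.rpow_le_rpow_of_nonpos hlogS hSr (by linarith)
  calc quality a b c ≤ B + c₁K * Real.log r ^ (θ - 1) := hq
    _ ≤ B + c₁K * Real.log (S : ℝ) ^ (θ - 1) := by
        have := mul_le_mul_of_nonneg_left hmono hc₁K0; linarith

/-! ### Iteration along squarings of the scale -/

/-- **Iteration.**  Under the threshold-2 form of the crux, if every quality is `≤ Q*` and every triple of radical
`≤ R` (`R ≥ 2`) has quality `≤ Q₀` (`Q₀ ≥ 0`), then every triple of radical `≤ R^{2ᵏ}` has quality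
`≤ Q₀ + c₁ (log R)^{θ-1} Σ_{j<k} (2^{θ-1})ʲ`, `c₁ = log⁺K + Q* log 2 + 2` (`step` at `S = R^{2ʲ}`,
`log S = 2ʲ log R`). [folklore] -/
theorem iterate {θ K Qs Q₀ : ℝ} {R : ℕ} (hθ0 : 0 ≤ θ) (hθ1 : θ ≤ 1) (hK : 0 < K)
    (hS : ∀ R₁ R₂ : ℕ, 2 ≤ R₁ → 2 ≤ R₂ → ∀ a b c : ℕ, IsABCTriple a b c → rad a b c ≤ R₁ * R₂ →
      ∃ a₁ b₁ c₁ a₂ b₂ c₂ : ℕ, IsABCTriple a₁ b₁ c₁ ∧ rad a₁ b₁ c₁ ≤ R₁ ∧ IsABCTriple a₂ b₂ c₂ ∧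
        rad a₂ b₂ c₂ ≤ R₂ ∧ (c : ℝ) ≤ K * Real.exp (Real.log ((R₁ : ℝ) * R₂) ^ θ) * c₁ * c₂)
    (hQs0 : 0 ≤ Qs) (hQs : ∀ a b c : ℕ, IsABCTriple a b c → quality a b c ≤ Qs)
    (h2R : 2 ≤ R) (hQ₀0 : 0 ≤ Q₀)
    (hQ₀ : ∀ a b c : ℕ, IsABCTriple a b c → rad a b c ≤ R → quality a b c ≤ Q₀) (k : ℕ) :
    ∀ a b c : ℕ, IsABCTriple a b c → rad a b c ≤ R ^ (2 ^ k) →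
      quality a b c ≤ Q₀ + (max (Real.log K) 0 + Qs * Real.log 2 + 2) * Real.log (R : ℝ) ^ (θ - 1) *
        ∑ j ∈ Finset.range k, ((2 : ℝ) ^ (θ - 1)) ^ j := by
  set c₁K : ℝ := max (Real.log K) 0 + Qs * Real.log 2 + 2 with hc₁K
  have hlog2 : 0 ≤ Real.log 2 := (Real.log_pos one_lt_two).le
  have hc₁K0 : 0 ≤ c₁K := by rw [hc₁K]; positivity
  have hR1 : (1 : ℝ) < R := by exact_mod_cast h2R
  have hlogR : 0 < Real.log (R : ℝ) := Real.log_pos hR1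
  have hρ0 : 0 ≤ (2 : ℝ) ^ (θ - 1) := Real.rpow_nonneg zero_le_two _
  induction k with
  | zero =>
    intro a b c hT hr
    rw [Finset.sum_range_zero, mul_zero, add_zero]
    exact hQ₀ a b c hT (by simpa using hr)
  | succ k ih =>
    intro a b c hT hr
    -- the scale `S = R^{2^k}` and the bound `B_k`
    have h2S : 2 ≤ R ^ 2 ^ k := le_trans h2R (Nat.le_self_pow (by positivity) R)
    have hsum0 : 0 ≤ ∑ j ∈ Finset.range k, ((2 : ℝ) ^ (θ - 1)) ^ j :=
      Finset.sum_nonneg fun j _ => pow_nonneg hρ0 j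
    have hB0 : 0 ≤ Q₀ + c₁K * Real.log (R : ℝ) ^ (θ - 1) * ∑ j ∈ Finset.range k, ((2 : ℝ) ^ (θ - 1)) ^ j :=
      add_nonneg hQ₀0 (mul_nonneg (mul_nonneg hc₁K0 (Real.rpow_nonneg hlogR.le _)) hsum0)
    have hr' : rad a b c ≤ R ^ 2 ^ k * R ^ 2 ^ k := by
      rw [← pow_add, ← two_mul, ← pow_succ']; exact hr
    have hstep := step hθ0 hθ1 hK hS hQs0 hQs h2S hB0 ih a b c hT hr'
    -- `log S = 2^k log R`, so `(log S)^{θ-1} = (2^{θ-1})^k (log R)^{θ-1}`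
    have hlogS : Real.log ((R ^ 2 ^ k : ℕ) : ℝ) = (2 : ℝ) ^ k * Real.log (R : ℝ) := by
      rw [Nat.cast_pow, Real.log_pow]; push_cast; ring
    have hpowS : Real.log ((R ^ 2 ^ k : ℕ) : ℝ) ^ (θ - 1) =
        ((2 : ℝ) ^ (θ - 1)) ^ k * Real.log (R : ℝ) ^ (θ - 1) := by
      rw [hlogS, Real.mul_rpow (by positivity) hlogR.le, ← Real.rpow_pow_comm zero_le_two]
    rw [hpowS] at hstep
    calc quality a b c
        ≤ Q₀ + c₁K * Real.log (R : ℝ) ^ (θ - 1) * ∑ j ∈ Finset.range k, ((2 : ℝ) ^ (θ - 1)) ^ j +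
            c₁K * (((2 : ℝ) ^ (θ - 1)) ^ k * Real.log (R : ℝ) ^ (θ - 1)) := hstep
      _ = Q₀ + c₁K * Real.log (R : ℝ) ^ (θ - 1) * ∑ j ∈ Finset.range (k + 1), ((2 : ℝ) ^ (θ - 1)) ^ j := by
          rw [Finset.sum_range_succ]; ring

/-- The geometric sum of the increments: `Σ_{j<k} (2^{θ-1})ʲ ≤ (1 - 2^{θ-1})⁻¹` for `θ < 1`. [folklore] -/
theorem geom_bound {θ : ℝ} (hθ1 : θ < 1) (k : ℕ) :
    ∑ j ∈ Finset.range k, ((2 : ℝ) ^ (θ - 1)) ^ j ≤ (1 - (2 : ℝ) ^ (θ - 1))⁻¹ := by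
  have hρ0 : 0 ≤ (2 : ℝ) ^ (θ - 1) := Real.rpow_nonneg zero_le_two _
  have hρ1 : (2 : ℝ) ^ (θ - 1) < 1 := Real.rpow_lt_one_of_one_lt_of_neg one_lt_two (by linarith)
  have := geom_sum_Ico_le_of_lt_one (m := 0) (n := k) hρ0 hρ1
  rw [pow_zero, ← Finset.range_eq_Ico] at this
  simpa [one_div] using this

end ScaleSubmultiplicativity.RecordSaturation

open ScaleSubmultiplicativity.RecordSaturation

/-! ### Record saturation -/

/-- **Saturation of the abc quality record under the crux.**  `ScaleSubmultiplicativity` (stmt-ABC-2160)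
implies: for some `θ ∈ [0,1)` and `C`, for EVERY scale `R ≥ 2` and every abc triple `T'` there is an abc triple `T`
of radical `≤ R` with `q(T') ≤ q(T) + C (log R)^{θ-1}` — the all-time supremum of abc qualities exceeds the
quality record up to scale `R` by at most `C (log R)^{θ-1} → 0`.  Threshold-2 normal form
(`ScaleSubmultiplicativity.iff_threshold_two`), boundedness of qualities (stmt-ABC-2163), and the squaring
iteration `iterate` with its geometric sum `geom_bound`; the record at scale `R` is `exists_record`. [folklore] -/
theorem ScaleSubmultiplicativity.recordSaturation_of_scaleSubmultiplicativity :
    Summit.ABC.ABC.Theses.FeketeScales.ScaleSubmultiplicativity →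
    ∃ θ : ℝ, 0 ≤ θ ∧ θ < 1 ∧ ∃ C : ℝ, ∀ R : ℕ, 2 ≤ R → ∀ a' b' c' : ℕ, IsABCTriple a' b' c' →
      ∃ a b c : ℕ, IsABCTriple a b c ∧ rad a b c ≤ R ∧
        quality a' b' c' ≤ quality a b c + C * Real.log (R : ℝ) ^ (θ - 1) := by
  intro h
  obtain ⟨Qs, hQs0, hQs⟩ := exists_quality_bound h
  obtain ⟨θ, hθ0, hθ1, K, hK, hS⟩ := ScaleSubmultiplicativity.iff_threshold_two.mp h
  set c₁K : ℝ := max (Real.log K) 0 + Qs * Real.log 2 + 2 with hc₁K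
  have hlog2 : 0 ≤ Real.log 2 := (Real.log_pos one_lt_two).le
  have hc₁K0 : 0 ≤ c₁K := by rw [hc₁K]; positivity
  have hρ1 : (2 : ℝ) ^ (θ - 1) < 1 := Real.rpow_lt_one_of_one_lt_of_neg one_lt_two (by linarith)
  have hden : 0 < 1 - (2 : ℝ) ^ (θ - 1) := by linarith
  refine ⟨θ, hθ0, hθ1, c₁K * (1 - (2 : ℝ) ^ (θ - 1))⁻¹, fun R hR a' b' c' hT' => ?_⟩
  obtain ⟨a, b, c, hT, hr, hmax⟩ := exists_record hR
  refine ⟨a, b, c, hT, hr, ?_⟩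
  have hQ₀0 : 0 ≤ quality a b c := quality_nonneg hT
  have hR1 : (1 : ℝ) < R := by exact_mod_cast hR
  have hlogR : 0 < Real.log (R : ℝ) := Real.log_pos hR1
  -- every triple sits below some squaring `R^{2^k}` of the scale
  set k : ℕ := rad a' b' c' with hk
  have hrk : rad a' b' c' ≤ R ^ 2 ^ k := by
    calc rad a' b' c' = k := rfl
      _ ≤ 2 ^ k := Nat.lt_two_pow_self.le
      _ ≤ R ^ k := Nat.pow_le_pow_left hR k
      _ ≤ R ^ 2 ^ k := Nat.pow_le_pow_right (by omega) Nat.lt_two_pow_self.le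
  have hit := iterate hθ0 hθ1.le hK hS hQs0 hQs hR hQ₀0 hmax k a' b' c' hT' hrk
  have hgeom := geom_bound hθ1 k
  have hfac : 0 ≤ c₁K * Real.log (R : ℝ) ^ (θ - 1) := mul_nonneg hc₁K0 (Real.rpow_nonneg hlogR.le _)
  calc quality a' b' c'
      ≤ quality a b c + c₁K * Real.log (R : ℝ) ^ (θ - 1) * ∑ j ∈ Finset.range k, ((2 : ℝ) ^ (θ - 1)) ^ j := hit
    _ ≤ quality a b c + c₁K * Real.log (R : ℝ) ^ (θ - 1) * (1 - (2 : ℝ) ^ (θ - 1))⁻¹ := by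
        have := mul_le_mul_of_nonneg_left hgeom hfac; linarith
    _ = quality a b c + c₁K * (1 - (2 : ℝ) ^ (θ - 1))⁻¹ * Real.log (R : ℝ) ^ (θ - 1) := by ring

end Summit.ABC.ABC.Theorems
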